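import Summits.ResolutionOfSingularities.ResolutionOfSingularities.Theorems.WeightedInvariantIota3IdealDescentExactR6Pos
import Summits.ResolutionOfSingularities.ResolutionOfSingularities.Theorems.WeightedInvariantIota3SigmaRatioAttained
import HarnessLib

/-!
# THE RATIO LETTER IS EXACT: `ν!·r₁ ≤ σ₁(f)·r₂` for every reached triple once `σ₁(f) > 0` (regular local, dimension three) — (R6⁺)₃ PROVED;
# the gap list of `stub_keyRungGrHomLE_three` with FOUR hypotheses (door `HypersurfaceCentreConstruction`, stmt-ResolutionOfSingularities-19897)

Topic: `Summits/ResolutionOfSingularities/ResolutionOfSingularities/Theorems`. Helper for the door item `HypersurfaceCentreConstruction`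
(stmt-ResolutionOfSingularities-19897, route `WeightedInvariant`), line `local-engine` (skeleton v3.12 `7a4b52ef`), def-free.  Sequel of
`keyRungGrHomLE_three_of_idealDescentExactR6Pos` (…Iota3IdealDescentExactR6Pos, p820412), whose hypothesis (R6⁺)₃ — the guarded EXACTNESS of the
ratio letter, the design obligation (R6) of …Iota3Sigma «that the floors lose nothing» — is PROVED here:

**`ratioScale_mul_le_sigmaRatioNat_mul`**: `S` regular local of dimension three, `f ∈ 𝔪 ∖ 0`, `ν = ord f`, `0 < σ₁(f)`; then every admissible triple
`(q; r₁, r₂)` reached by `f` has `ν!·r₁ ≤ σ₁(f)·r₂`.  Proof: SMALL DENOMINATORS DOMINATE (res-D-pv-038's `RatContact.exists_ceilDiv_eq_of_denom_le` +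
`ratContactFiltration_level_eq_of_ceilDiv_eq`, …Iota3SigmaRatioAttained): the one-flag reach of the first member at `r₁/r₂` is also a reach at a slope
`a'/b' ≥ r₁/r₂` with `b' ≤ ν` (same ceiling vector `(⌈j·a/b⌉)_{j ≤ ν}`), hence a two-flag reach of `(b'; a', b')`
(`JFlatEssSmooth.flagReaches_of_oneFlagReaches`); `b' ∣ ν!`, so `m = (ν!/b')·a'` is an honest witness `m·b' ≤ ν!·a'` of the scaled sup, `m ≤ σ₁(f)`
(the witness set is bounded because `σ₁(f) > 0` — `Nat.sSup` of an unbounded set is `0`), and `ν!·r₁ ≤ m·r₂ ≤ σ₁·r₂`.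

* §2 **`keyRungGrHomLE_three_of_idealDescentExact4`** — THE GAP LIST WITH FOUR HYPOTHESES: (desc-τ); **(IDLexact)₃** «along a 𝔪-preserving local
  formally smooth e.f.t. `φ : A → A'` of regular local rings of dimension three, for `g ∈ 𝔪_A ∖ 0`, the two levels `F'(r₁)`, `F'(r₂)` of every two-flag
  of `A'` carrying `φ g` to an admissible `(q; r₁, r₂)` with `q < r₂` whose ratio bounds every upstairs reach exactly are extended from `A`»; hgame; the
  residue of the dominance word at the power positions.  Chain of this hand: (σ-ext) [p819102's hyp] ⟸ (σ-ext)₃ (p819524) ⟸ (LVL-desc)₃ (p819685) ⟸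
  (IDL-desc)₃ (p819841) ⟸ (IDLexact)₃ ∧ (R6⁺)₃ (p820412) ⟸ (IDLexact)₃ (here); GAP 2 ⟸ (IDLexact)₃ (p820262).

[OURS · L1 W4.3 · kernel lemma + audit glue]  Replaces the role of NO printed item; NOT a statement of the manuscript [claim: Hironaka2017, status:
under-review]; candidates stay candidates; AI work, weaker than expert review.  No definition; no axiom.

## References

* H. Hironaka, *Characteristic polyhedra of singularities*, J. Math. Kyoto Univ. 7 (1967), §3. [Hironaka1967]
-/

noncomputable section

set_option linter.dupNamespace false -- mandated namespace `Summit.<Summit>.<Problem>` of this single-conjunct summit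

open IsLocalRing Literature.AlgebraicGeometry.Resolution
open Summit.ResolutionOfSingularities.ResolutionOfSingularities.Theorems
open Summit.ResolutionOfSingularities.ResolutionOfSingularities.Cruxes.HypersurfaceCentreConstruction.LocalEngine.Iota3.RatContact

namespace Summit.ResolutionOfSingularities.ResolutionOfSingularities.Cruxes.HypersurfaceCentreConstruction.LocalEngine

namespace Iota3

/-! ## §1 Exactness of the ratio letter -/

section Exact

variable {S : Type} [CommRing S] [IsRegularLocalRing S]

/-- **THE RATIO LETTER IS EXACT (R6⁺)**: in a regular local ring of dimension three, for `f ∈ 𝔪 ∖ 0` with `0 < σ₁(f)`, every admissible triple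
`(q; r₁, r₂)` reached by `f` satisfies `ν!·r₁ ≤ σ₁(f)·r₂` — small denominators dominate, so the scaled sup loses nothing to the floors.
[OURS · L1 W4.3 · obligation (R6)] -/
theorem ratioScale_mul_le_sigmaRatioNat_mul (hdim : ringKrullDim S = (3 : ℕ)) {f : S} (hf0 : f ≠ 0) (hf : f ∈ maximalIdeal S)
    (hσ : 0 < sigmaRatioNat f) {q r₁ r₂ : ℕ} (hadm : AdmissibleTriple q r₁ r₂) (hreach : FlagReaches f (adicOrder f).toNat q r₁ r₂) :
    ratioScale (adicOrder f).toNat * r₁ ≤ sigmaRatioNat f * r₂ := by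
  obtain ⟨hν, -, -⟩ := EssSmoothLevels.adicOrder_toNat_spec hf0 hf
  have hr₂ : 0 < r₂ := hadm.pos.2.1
  -- the witness set is bounded (else `σ₁ = 0`)
  have hbdd : BddAbove {m : ℕ | ∃ q r₁ r₂ : ℕ, AdmissibleTriple q r₁ r₂ ∧ FlagReaches f (adicOrder f).toNat q r₁ r₂ ∧
      m * r₂ ≤ ratioScale (adicOrder f).toNat * r₁} := by
    by_contra h
    have h0 : sigmaRatioNat f = 0 := by
      unfold sigmaRatioNat
      rw [csSup_of_not_bddAbove h, csSup_empty, bot_eq_zero]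
    exact hσ.ne' h0
  -- small denominators dominate: a slope `a'/b' ≥ r₁/r₂` with `b' ≤ ν` and the same ceilings
  obtain ⟨a', b', hb', hb'ν, hab, hceil⟩ := exists_ceilDiv_eq_of_denom_le (a := r₁) (b := r₂) (ν := (adicOrder f).toNat) hr₂ hν
  obtain ⟨g₁, hg₁, hg₁2, hmem⟩ := FlagReaches.oneFlagReaches hadm hreach
  have hmem' : f ∈ ratContactFiltration g₁ a' b' (a' * (adicOrder f).toNat) := by
    rw [ratContactFiltration_level_eq_of_ceilDiv_eq g₁ hceil]; exact hmem
  have hb'a' : b' ≤ a' := by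
    have h1 : r₂ * b' ≤ a' * r₂ := (Nat.mul_le_mul_right _ hadm.2.2).trans hab
    rw [mul_comm a' r₂] at h1
    exact Nat.le_of_mul_le_mul_left h1 hr₂
  have hreach' : FlagReaches f (adicOrder f).toNat b' a' b' :=
    JFlatEssSmooth.flagReaches_of_oneFlagReaches hdim ⟨g₁, hg₁, hg₁2, hmem'⟩
  -- the honest witness `m = (ν!/b') a'`
  have hdvd : b' ∣ ratioScale (adicOrder f).toNat := by unfold ratioScale; exact Nat.dvd_factorial hb' hb'ν
  have hmW : ratioScale (adicOrder f).toNat / b' * a' ∈ {m : ℕ | ∃ q r₁ r₂ : ℕ, AdmissibleTriple q r₁ r₂ ∧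
      FlagReaches f (adicOrder f).toNat q r₁ r₂ ∧ m * r₂ ≤ ratioScale (adicOrder f).toNat * r₁} := by
    refine ⟨b', a', b', ⟨hb', le_rfl, hb'a'⟩, hreach', le_of_eq ?_⟩
    calc ratioScale (adicOrder f).toNat / b' * a' * b' = ratioScale (adicOrder f).toNat / b' * b' * a' := by ring
      _ = ratioScale (adicOrder f).toNat * a' := by rw [Nat.div_mul_cancel hdvd]
  have hmle : ratioScale (adicOrder f).toNat / b' * a' ≤ sigmaRatioNat f := by
    unfold sigmaRatioNat; exact le_csSup hbdd hmW
  -- `ν! r₁ b' ≤ ν! a' r₂ = m b' r₂`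
  have h1 : ratioScale (adicOrder f).toNat * r₁ * b' ≤ ratioScale (adicOrder f).toNat / b' * a' * r₂ * b' :=
    calc ratioScale (adicOrder f).toNat * r₁ * b' = ratioScale (adicOrder f).toNat * (r₁ * b') := by ring
      _ ≤ ratioScale (adicOrder f).toNat * (a' * r₂) := Nat.mul_le_mul_left _ hab
      _ = ratioScale (adicOrder f).toNat / b' * b' * a' * r₂ := by rw [Nat.div_mul_cancel hdvd]; ring
      _ = ratioScale (adicOrder f).toNat / b' * a' * r₂ * b' := by ring
  exact (Nat.le_of_mul_le_mul_right h1 hb').trans (Nat.mul_le_mul_right _ hmle)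

end Exact

end Iota3

/-! ## §2 The gap list with four hypotheses -/

open Iota3 in
/-- **P3 RUNG FOR THE NAMED PAIR MODULO FOUR HYPOTHESES**: (desc-τ); **(IDLexact)₃** «along a 𝔪-preserving local formally smooth e.f.t. `φ : A → A'` of
regular local rings of dimension three, for `g ∈ 𝔪_A ∖ 0`, the levels `F'(r₁)`, `F'(r₂)` of every two-flag of `A'` carrying `φ g` to an admissible
`(q; r₁, r₂)` with `q < r₂` whose ratio bounds every upstairs reach (`r₁'·r₂ ≤ r₁·r₂'`) are extended from `A`» (σ-maximiser / (J-can) ideal descent — the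
one σ/J input left); hgame; the residue of the dominance word at the power positions. [OURS · L1 W4.3 · audit glue] -/
theorem keyRungGrHomLE_three_of_idealDescentExact4 (p : ℕ)
    (hD : ∀ (T T' : Type) [CommRing T] [IsRegularLocalRing T] [CommRing T'] [IsRegularLocalRing T'] [Algebra T T']
      [IsLocalHom (algebraMap T T')] [Algebra.FormallySmooth T T'] [Algebra.EssFiniteType T T'] (g : T),
      ringKrullDim T' ≤ 3 → IsTiePosition T' (algebraMap T T' g) → IsTiePosition T g)
    (hidlx : ∀ (T T' : Type) [CommRing T] [IsRegularLocalRing T] [CommRing T'] [IsRegularLocalRing T'] [Algebra T T']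
      [IsLocalHom (algebraMap T T')] [Algebra.FormallySmooth T T'] [Algebra.EssFiniteType T T'] (g : T),
      ringKrullDim T = (3 : ℕ) → ringKrullDim T' = (3 : ℕ) → (maximalIdeal T).map (algebraMap T T') = maximalIdeal T' →
      g ≠ 0 → g ∈ maximalIdeal T → ∀ (g₁' g₂' : T') (q r₁ r₂ : ℕ), IsTwoFlag g₁' g₂' → AdmissibleTriple q r₁ r₂ → q < r₂ →
      algebraMap T T' g ∈ flagContactFiltration g₁' g₂' q r₁ r₂ (r₁ * (adicOrder g).toNat) →
      (∀ q' r₁' r₂' : ℕ, AdmissibleTriple q' r₁' r₂' → FlagReaches (algebraMap T T' g) (adicOrder g).toNat q' r₁' r₂' →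
        r₁' * r₂ ≤ r₁ * r₂') →
      ∃ J₁ J₂ : Ideal T, J₁.map (algebraMap T T') = flagContactFiltration g₁' g₂' q r₁ r₂ r₁ ∧
        J₂.map (algebraMap T T') = flagContactFiltration g₁' g₂' q r₁ r₂ r₂)
    (hgame : CanonicalGameClauseHomLE 3 p iotaFlatT jFlatT)
    (hres : ∀ (k₀ : Type) [Field k₀] [CharP k₀ p] [PerfectField k₀]
      (S : Type) [CommRing S] [Algebra k₀ S] [Algebra.EssFiniteType k₀ S] [IsRegularLocalRing S] (f : S),
      ringKrullDim S = (3 : ℕ) → f ≠ 0 → f ∈ (maximalIdeal S) ^ 2 →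
      ContactCylinder.topStratumPrime iotaOrdEpsTau S f = maximalIdeal S → iotaEps S f ≠ 1 →
      (∃ ℓ ∈ maximalIdeal S, f ∈ Ideal.span {ℓ ^ (adicOrder f).toNat} ⊔ maximalIdeal S ^ ((adicOrder f).toNat + 1)) →
      ∀ (a b : ℕ), 0 < b →
      (∀ q' r₁' r₂' : ℕ, AdmissibleTriple q' r₁' r₂' → FlagReaches f (adicOrder f).toNat q' r₁' r₂' → r₁' * b ≤ a * r₂') →
      ∀ (g₁ g₂ g₁' g₂' : S) (q r₁ r₂ : ℕ), AdmissibleTriple q r₁ r₂ → r₁ * b = a * r₂ → q < r₂ → r₂ < r₁ →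
        IsTwoFlag g₁ g₂ → IsTwoFlag g₁' g₂' →
        f ∈ flagContactFiltration g₁ g₂ q r₁ r₂ (r₁ * (adicOrder f).toNat) →
        f ∈ flagContactFiltration g₁' g₂' q r₁ r₂ (r₁ * (adicOrder f).toNat) →
        g₂' ∈ flagContactFiltration g₁ g₂ q r₁ r₂ r₂) :
    KeyRungGrHomLE 3 p :=
  keyRungGrHomLE_three_of_idealDescentExactR6Pos p hD hidlx
    (fun _ _ _ _ hd hf0 hf hσ _ _ _ hadm hreach => ratioScale_mul_le_sigmaRatioNat_mul hd hf0 hf hσ hadm hreach) hgame hres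

end Summit.ResolutionOfSingularities.ResolutionOfSingularities.Cruxes.HypersurfaceCentreConstruction.LocalEngine

end
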